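import Mathlib
import HarnessLib
import HarnessLib.Audit
import Summits.QuantumAdvantage.AdviceFreeQNC0.ChargeRecursion
import Summits.QuantumAdvantage.AdviceFreeQNC0.OddPrimeStatements
import Summits.QuantumAdvantage.AdviceFreeQNC0.WalkCoreBasics
import Summits.QuantumAdvantage.QuantumAdvantage.Theorems.RigidityLawsB
import Summits.QuantumAdvantage.QuantumAdvantage.Theorems.FibreDialB
import Literature.Computability.MetaComplexity.LowDegreeClosure

/-!
# LengthDial, part A/7 (§0–§2: walk bookkeeping, the win bit as a `ZMod 2` sum, and the MERGE LEMMA `ringWinU_merge` (off-diagonal absorption)) — support for item stmt-QuantumAdvantage-28401 (`Theses.AbsorptionDial.MassHiQuasi`)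

Cell decomp-qadv, seat lens-5 («finite range + asymptotic regime + bridge»), generation 26 — land port of the node
«LengthDial» (published under the cell's HOME/decomp-qadv-lens-5/g26/LengthDial.lean, record NODE-g26.md; RESIDUAL MODE on
AbsorptionDial:28401 `MassHiQuasi`).  The node file with ONLY the namespace renamed `Theses.LengthDial → Theorems.LengthDial`
and split at section boundaries into parts A–G (each importing the previous; part G alone imports the route file
Theses.AbsorptionDial for the BY-NAME equivalences and `closes`).  Prop-defs = the node's hardness predicates / grades only.
Tree facts reused by name, not restated: `RigidityLaws.walkExp_zero/self`, `RigidityLaws.ringWinU_congr_mod`,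
`RigidityLaws.threeCharge`, `RigidityLaws.hasDegF_xor`, `FibreDial.const_of_hasDegF_zero`, `WalkCoreBasics.ringWinU_compl`, `chargeRecursion`, `sliceAt_mem_lowDeg`,
`Smolensky.comp_mem_lowDeg_of_coord`.  No `sorry`, no new axioms, no instances, no notation.

NODE SYNOPSIS (all parts):

# LengthDial (cell decomp-qadv, lens-5 «finite range + asymptotic regime + bridge», g26)

THE LENGTH AXIS of the u-walk game `ringWinU` (charge `c`, length `n`, cuts `0..n`): the
ONE-BIT PEEL ABSORPTION LAW and its consequences, kernel-checked.  Target: the route residual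
`AbsorptionDial.MassHiQuasi` (stmt-QuantumAdvantage-28401, `QuarterFloor → Q`).

* §0–§1  walk bookkeeping (tree: `RigidityLaws.walkExp_zero/self`); the win bit as a `ZMod 2` sum.
* §2     MERGE LEMMA (off-diagonal absorption): in a game `(m, c')` with `c' % 3 ≠ m % 3` the two end
         cuts test DIFFERENT residues of the weight, so any extra term `e(u) ∧ [(r + |u|) % 3 ≠ 0]` is
         XOR-absorbed into cuts `0` and/or `m` (`ringWinU_merge`).
* §3     PEEL LAW: peeling the first input bit (`chargeRecursion`, tree) lands in the game
         `(n, c+1+2b)`; if that game is off-diagonal the cut-0 term is absorbed (`ringWinU_peel1`);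
         if it is diagonal, the SECOND peel is always off-diagonal (`c2_offDiag`) and both extra terms
         are absorbed (`ringWinU_peel2`).  Win counts: `winCount_peel`.
* §4     degree bookkeeping over `𝔽_p` (restriction free; XOR additive — tree `RigidityLaws.hasDegF_xor`):
         peeled strategies have cut degree `≤ 5D`.
* §5     THE LAW: off-diagonal hardness at lengths `k+1, k` against degree `5D` ⟹ hardness at length
         `k+2`, ALL charges, degree `D`, same value bound (`lengthLaw`).  REACH: a consecutive pair at
         degree `5^s·D` certifies the next `s` lengths at degree `D` (`reach`).
* §6     EQUIVALENCES R ⟺ R_off (only charges `c ≢ n (mod 3)`) at every grade of the AbsorptionDial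
         ladder: X = `NoPerfectPolyOdd` (28487), the residual `MassHiQuasi` (28401), the aside
         T = `WalkPolyLossOdd` (26767), and the leaf crux `WalkHardF p`; `closes_off` BY NAME.
* §7     XOR-closed cut classes: two consecutive lengths bound ALL later lengths (`CutClass.twoLengths`).
* §8     complement symmetry `u ↦ ū` (tree: `WalkCoreBasics.ringWinU_compl`) swaps the two off-diagonal
         classes ⟹ ONE charge class `c ≡ n+1 (mod 3)` decides every grade (R ⟺ R_one);
         `closes : MassHiQuasiOne → AbsorptionDial.MassHiQuasi` BY NAME.
* §9     the DEGREE-0 SLICE DECIDED for every prime `p` and every `n ≥ 4` (`degZeroHard`, value `≤ 3/4`):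
         finite range `{2, 3}` by `decide` (`oblBound_*`) + the law's `reach` (lossless at `D = 0`).
* §10    `p = 2`: a fixed `𝔽₂`-degree is an XOR-closed class, so eventual hardness at fixed degree is
         EQUIVALENT to hardness at two consecutive lengths (`eventuallyHard_charTwo_iff`).
* §11    PADDING (the other direction): easiness on a charge pair lifts one length up at the same degree
         (`winCount_pad`, `pairBound_of_hardR`); three-charge parity in the form used (tree: `threeCharge`).
* §12    THE SPLIT a LOSSLESS law would give: `closes_split : LawPiece → SeedPiece → AbsorptionDial.MassHiQuasi`
         — `LawPiece` (the law without its factor 5: UNDECIDED; rung `D = 0` PROVED `losslessLaw_zero`, `D = 1`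
         verified exhaustively to length 7) and `SeedPiece` (i.o. hard pairs: WEAKER, `seedPiece_of_massHiQuasi`).

Namespace `Summit.QuantumAdvantage.QuantumAdvantage.Theorems.LengthDial` (parts A–G).
-/

set_option autoImplicit false
set_option linter.unusedVariables false
set_option linter.dupNamespace false
set_option linter.style.longLine false

namespace Summit.QuantumAdvantage.QuantumAdvantage.Theorems.LengthDial

open Finset
open Summit.QuantumAdvantage.AdviceFreeQNC0
open Literature.Computability.MetaComplexity Literature.Computability.MetaComplexity.Smolensky

/-! ## §0 Walk bookkeeping -/

section Walk
variable {n : ℕ}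


/-! ## §1 The win bit as a `ZMod 2` sum -/

/-- `[a]` in `ZMod 2`. -/
def bz (a : Bool) : ZMod 2 := if a then 1 else 0

/-- `bz true = 1`. -/
@[simp] theorem bz_true : bz true = 1 := rfl
/-- `bz false = 0`. -/
@[simp] theorem bz_false : bz false = 0 := rfl

/-- countedness of cut `g` at charge `c` on input `u`. -/
def cnt (c : ℕ) (u : Fin n → Bool) (g : Fin (n + 1)) : Bool :=
  decide ((c + g.val + walkExp u g.val) % 3 ≠ 0)

/-- the win parity as a `ZMod 2` sum over the cuts. -/
def winSum (c : ℕ) (y : Fin (n + 1) → (Fin n → Bool) → Bool) (u : Fin n → Bool) : ZMod 2 :=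
  ∑ g : Fin (n + 1), bz (y g u && cnt c u g)

/-- the win bit is the parity `winSum` (a `ZMod 2` sum over the cuts). -/
theorem ringWinU_eq_decide (c : ℕ) (y : Fin (n + 1) → (Fin n → Bool) → Bool) (u : Fin n → Bool) :
    ringWinU c y u = decide (winSum c y u = 1) := by
  unfold ringWinU winSum
  have hcard : (((univ.filter fun g : Fin (n + 1) =>
      y g u = true ∧ (c + g.val + walkExp u g.val) % 3 ≠ 0).card : ℕ) : ZMod 2)
      = ∑ g : Fin (n + 1), bz (y g u && cnt c u g) := by
    rw [Finset.card_filter, Nat.cast_sum]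
    refine Finset.sum_congr rfl fun g _ => ?_
    unfold bz cnt
    by_cases h1 : y g u = true <;> by_cases h2 : (c + g.val + walkExp u g.val) % 3 ≠ 0 <;> simp [h1, h2]
  have key : ∀ x : ℕ, ((x : ZMod 2) = 1 ↔ x % 2 = 1) := by
    intro x
    rw [← ZMod.natCast_mod x 2]
    rcases Nat.mod_two_eq_zero_or_one x with h | h <;> (rw [h]; simp)
  apply Bool.decide_congr
  rw [← hcard, key]

end Walk


/-! ## §2 The merge lemma (off-diagonal absorption) -/

section Merge
variable {m : ℕ}

/-- which end cuts absorb the extra test `[(r + |u|) % 3 ≠ 0]` in the game `(m, c)`: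
cut `0` tests `[(c + |u|) % 3 ≠ 0]`, cut `m` tests `[(c + m + 2|u|) % 3 ≠ 0]`. -/
def mergeCoef (r c m : ℕ) : Bool × Bool :=
  if r % 3 = c % 3 then (true, false)
  else if r % 3 = (2 * (c % 3) + 2 * (m % 3)) % 3 then (false, true) else (true, true)

/-- the merge coefficients only depend on the residues mod `3`. -/
theorem mergeCoef_mod (r c m : ℕ) : mergeCoef r c m = mergeCoef (r % 3) (c % 3) (m % 3) := by
  unfold mergeCoef
  simp only [Nat.mod_mod]

/-- XOR the extra output `e` into cut `0` and/or cut `m`. -/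
def merge (r c : ℕ) (e : (Fin m → Bool) → Bool) (z : Fin (m + 1) → (Fin m → Bool) → Bool) :
    Fin (m + 1) → (Fin m → Bool) → Bool :=
  fun g u => xor (xor (z g u) ((mergeCoef r c m).1 && decide (g.val = 0) && e u))
    ((mergeCoef r c m).2 && decide (g.val = m) && e u)

/-- finite key fact behind `merge_residue` (all residues mod `3`, by `decide`). -/
private theorem key3 : ∀ ρ < 3, ∀ a < 3, ∀ b < 3, ∀ w < 3, a ≠ b →
    bz ((mergeCoef ρ a b).1 && decide ((a + w) % 3 ≠ 0))
      + bz ((mergeCoef ρ a b).2 && decide ((a + b + 2 * w) % 3 ≠ 0))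
      = bz (decide ((ρ + w) % 3 ≠ 0)) := by
  decide

/-- residue identity: the merged end-cut indicators reproduce the absorbed term (off-diagonal games). -/
theorem merge_residue (r c m W : ℕ) (hoff : c % 3 ≠ m % 3) :
    bz ((mergeCoef r c m).1 && decide ((c + W) % 3 ≠ 0))
      + bz ((mergeCoef r c m).2 && decide ((c + m + 2 * W) % 3 ≠ 0))
      = bz (decide ((r + W) % 3 ≠ 0)) := by
  have h := key3 (r % 3) (Nat.mod_lt _ (by norm_num)) (c % 3) (Nat.mod_lt _ (by norm_num))
    (m % 3) (Nat.mod_lt _ (by norm_num)) (W % 3) (Nat.mod_lt _ (by norm_num)) hoff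
  rw [mergeCoef_mod]
  have e1 : (c + W) % 3 = (c % 3 + W % 3) % 3 := by omega
  have e2 : (c + m + 2 * W) % 3 = (c % 3 + m % 3 + 2 * (W % 3)) % 3 := by omega
  have e3 : (r + W) % 3 = (r % 3 + W % 3) % 3 := by omega
  rw [e1, e2, e3]
  exact h

/-- `winSum` of the merged strategy = absorbed term + `winSum` of the original (in `ZMod 2`). -/
theorem winSum_merge (r c : ℕ) (e : (Fin m → Bool) → Bool) (z : Fin (m + 1) → (Fin m → Bool) → Bool)
    (u : Fin m → Bool) :
    winSum c (merge r c e z) u = winSum c z u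
      + bz ((mergeCoef r c m).1 && e u && cnt c u 0)
      + bz ((mergeCoef r c m).2 && e u && cnt c u (Fin.last m)) := by
  unfold winSum merge
  have split : ∀ g : Fin (m + 1),
      bz ((xor (xor (z g u) ((mergeCoef r c m).1 && decide (g.val = 0) && e u))
        ((mergeCoef r c m).2 && decide (g.val = m) && e u)) && cnt c u g)
      = bz (z g u && cnt c u g)
        + bz ((mergeCoef r c m).1 && decide (g.val = 0) && e u && cnt c u g)
        + bz ((mergeCoef r c m).2 && decide (g.val = m) && e u && cnt c u g) := by
    intro g
    generalize z g u = a
    generalize (mergeCoef r c m).1 = α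
    generalize (mergeCoef r c m).2 = β
    generalize decide (g.val = 0) = d0
    generalize decide (g.val = m) = dm
    generalize e u = ee
    generalize cnt c u g = cc
    revert a α β d0 dm ee cc
    decide
  rw [Finset.sum_congr rfl (fun g _ => split g), Finset.sum_add_distrib, Finset.sum_add_distrib]
  congr 1
  congr 1
  · rw [Finset.sum_eq_single (0 : Fin (m + 1))]
    · simp
    · intro g _ hg
      have hg' : g.val ≠ 0 := fun h => hg (Fin.ext (by rw [h, Fin.val_zero]))
      simp [hg']
    · intro h
      exact absurd (Finset.mem_univ _) h
  · rw [Finset.sum_eq_single (Fin.last m)]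
    · simp
    · intro g _ hg
      have hg' : g.val ≠ m := fun h => hg (Fin.ext (by rw [h, Fin.val_last]))
      simp [hg']
    · intro h
      exact absurd (Finset.mem_univ _) h

/-- **MERGE LEMMA (off-diagonal absorption).** -/
theorem ringWinU_merge (r c : ℕ) (hoff : c % 3 ≠ m % 3) (e : (Fin m → Bool) → Bool)
    (z : Fin (m + 1) → (Fin m → Bool) → Bool) (u : Fin m → Bool) :
    ringWinU c (merge r c e z) u = xor (e u && decide ((r + wt u) % 3 ≠ 0)) (ringWinU c z u) := by
  rw [ringWinU_eq_decide, ringWinU_eq_decide, winSum_merge]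
  have h0 : cnt c u 0 = decide ((c + wt u) % 3 ≠ 0) := by
    simp [cnt, RigidityLaws.walkExp_zero]
  have hm : cnt c u (Fin.last m) = decide ((c + m + 2 * wt u) % 3 ≠ 0) := by
    simp [cnt, RigidityLaws.walkExp_self, two_mul]
  rw [h0, hm]
  have key := merge_residue r c m (wt u) hoff
  cases he : e u
  · simp
  · simp only [Bool.true_and, Bool.and_true] at key ⊢
    rw [add_assoc, key]
    generalize winSum c z u = s
    generalize decide ((r + wt u) % 3 ≠ 0) = t
    revert s t
    decide

end Merge

end Summit.QuantumAdvantage.QuantumAdvantage.Theorems.LengthDial
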